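import Literature.MathematicalPhysics.QuantumFieldTheory.BalabanImbrieJaffe1984to88.BIJ88Eq5134TwoSpecies
import Literature.MathematicalPhysics.QuantumFieldTheory.BalabanImbrieJaffe1984to88.BIJ88Resummation5141Adm

/-!
# `BalabanImbrieJaffe1984to88.BIJ88Eq5141TwoSpecies` — T. Bałaban, J. Imbrie, A. Jaffe, *Effective action and cluster properties of the
abelian Higgs model*, Commun. Math. Phys. **114** (1988) 257–315 [BalabanImbrieJaffe1988], §5.14 p. 308 [PDF 52]: **display (5.14.1)**,
*"To extract the perturbative terms, we resum the decoupling and Mayer expansions in Λ^{(k)}_{12}. … Σ_{{X_α}} Π_α g₂(X_α) = Σ_{{X_α} overlapping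
Λ^{(k)c}_{11}} Π_α g₂(X_α) z_F(Λ^{(k)}_{12}) (5.14.1)"* — DERIVED FOR THE HONEST `S`-SUMMED EXPANSION of this seat's `BIJ88MayerExchange5134` /
`BIJ88Eq5134TwoSpecies` (the two-species polymer gas which (5.13.4) actually is once the Mayer sums `Σ_{S_Y}Σ_{S_5}` are exchanged with the sum over
the cluster configurations of the `S`-dependent elementary regions): (A) the split of the two-species sum into the families `{X_α}` overlapping
Λ₁₁ᶜ (with their multi-region sub-family `M`) and an INNER two-species sum over Λ₁₂ in which the multi-region polymers keep away from the outer
interpolated ones; (B) the inner sum RESUMMED BACK (*"we resum the decoupling and Mayer expansions in Λ^{(k)}_{12}"*): it equals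
`Σ_{S′ ⊆ 𝒫(Λ₁₂)} z_{S′}(I₁₂(S′))(I₁₂(S′) ∖ ∂_M)` — for each inner Mayer set `S′` the expectation over the fields of Λ₁₂ of its elementary-region factors,
with the regions of `S′` that abut an outer multi-region polymer DECOUPLED. Continuation of the reading note GAPS.md G-C2-p25-03: the print's inner
factor `z_F(Λ₁₂) = ⟨χ′ Π F e^{−Ṽ(Λ₁₂)}⟩_{1,Λ₁₂}` (fully coupled, Mayer-resummed) is what one gets by ignoring that layer; honestly the decoupled layer
is a union of `S′`-dependent regions, so the Mayer sum in Λ₁₂ does not close up into `e^{−Ṽ}` at the letter.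

statement-level skeleton of published theorems with citation tags; proofs where landed; nothing here is a claim about the Yang–Mills mass gap

PDF held: `paper:balaban1988-cmp114-bij-abelian-higgs-effective-action` (journal page = PDF page + 256); p. 306 = PDF 50, p. 308 = PDF 52 (rendered and
read as images this session, `renders/original-p050-x2.png`, `…p052-x2.png` of the p25 seat).

**The print (verbatim, p. 308).** *"To extract the perturbative terms, we resum the decoupling and Mayer expansions in Λ^{(k)}_{12}. Note that
W^{(k)}_5(X) ≠ 0 only for X at the boundary of Λ^{(k)}_{10}. Thus W^{(k)}_5-terms will not appear in the resummed expansion. We obtain for the expansion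
in (5.13.4) Σ_{{X_α}} Π_α g₂(X_α) = Σ_{{X_α} overlapping Λ^{(k)c}_{11}} Π_α g₂(X_α) z_F(Λ^{(k)}_{12}), where z_F(Λ^{(k)}_{12}) = ⟨χ′_{Λ^{(k)}_{12}} Π_{σ₁:
X_{σ₁}⊂Λ^{(k)}_{12}} F^{m̄}_{k,loc}(X_{σ₁}) e^{−Ṽ^{(k)}(Λ^{(k)}_{12})}⟩_{1,Λ^{(k)}_{12}}, Ṽ^{(k)}(Λ^{(k)}_{12}) = Σ_{Y⊂Λ^{(k)}_{12}} V^{(k)}(Y). (5.14.1)"*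

**Setting** (that of `BIJ88MayerExchange5134` / `BIJ88Eq5134TwoSpecies`, plus the large-field cubes `B` and the outer families of this seat's gen-7
`BIJ88Resummation5141`): cubes `ι`, `W` = the cubes of Λ₁₀, `B` = those meeting Λ₁₁ᶜ, `adj` = abutting, `Ys` = the Mayer polymers, `J₀` = the joining
sets of rules (iii)–(iv), `outer W B` = the families `{X_α}` *"overlapping Λ^{(k)c}_{11}"*, `lam12 W ρ` = Λ₁₂, two-species weights `gA`/`gB`, hard core
`HardCore`, the elementary regions of `X` for local data `T` = `localI J₀ X T`.

**What is proved (0 `sorry`, standard axioms, 0 new `Prop` facts; finite identities).**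
* §1 `Avoid adj E X` (no cube of `X` abuts, or is abutted by, a cube of `E`), `avoid_biUnion_iff`, `hardCore_union_iff` (the hard core of `M_o ∪ M_i` =
  hard core of each + the inner polymers avoid `∪M_o`), `union_sdiff_union`, `sum_hardCore_union`, **`twoSpecies_split`** — (A): for all weights
  `a, b` and every per-polymer constraint `c`,
  `Σ_{Q filling of W, c} Σ_{M ⊆ Q hard-core} Π_M b Π_{Q∖M} a = Σ_{ρ ∈ outer W B, c} Σ_{M_o ⊆ ρ hard-core} (Π_{M_o} b Π_{ρ∖M_o} a) · Σ_{κ filling of Λ₁₂, c}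
  Σ_{M_i ⊆ κ hard-core, avoiding ∪M_o} Π_{M_i} b Π_{κ∖M_i} a`.
* §2 (B) THE INNER RESUMMATION: `localI_restrict` / `gA_restrict` / `gB_restrict` (the species inside Λ₁₂ may be computed with the rules inside Λ₁₂),
  `isClosed_restrict_iff`, `isClosed_lam12` (Λ₁₂ is closed under the rules when the outer polymers are), `localI_eq_filter_of_subset` (the regions of
  an inner Mayer set in Λ₁₂ are global regions), `inner_fixed` (at fixed inner Mayer data: gen-8 `BIJ88Resummation5141Adm.sum_adm_bigPart_subset` — the
  admissible fillings whose multi-region members avoid `E` resum to `z S′ I′ (I′ ∖ ∂_E)`), **`inner_resummed`** (the inner two-species sum over Λ₁₂ with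
  the multi-region polymers avoiding `E` `= Σ_{S′ ⊆ 𝒫(Λ₁₂)} z S′ (localI J₀ Λ₁₂ S′) ((localI J₀ Λ₁₂ S′).filter (Avoid adj E))`, by `exchange5134_cond`
  read backwards and `inner_fixed`).
* §3 **`eq5141_twoSpecies`** — (5.14.1), honest form: for local cluster-factorizing corner data `z` (hypotheses `hz`, `hloc` of `eq5134_right`),
  `Σ_{S ⊆ 𝒫(W)} z S I(S) I(S) = Σ_{ρ ∈ outer W B, J₀-closed} Σ_{M_o ⊆ ρ hard-core} (Π_{M_o} gB Π_{ρ∖M_o} gA) · Σ_{S′ ⊆ 𝒫(Λ₁₂)} z S′ (I₁₂ S′) ((I₁₂ S′).filter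
  (Avoid (∪M_o)))` with `I₁₂ S′ = localI J₀ (lam12 W ρ) S′`; `eq5141_twoSpecies_zLoc` (non-vacuity for the supply `zLoc`).

**Reading note (GAPS.md G-C2-p25-03, continued).** Gen 8 (`BIJ88Resummation5141Adm.eq5141_adm`) located, at fixed Mayer data, the imprecision of the
printed inner factor: the cubes of Λ₁₂ abutting an interpolated outer polymer are decoupled. With the Mayer sums in place the decoupled part of Λ₁₂ is
the union of those ELEMENTARY REGIONS of the inner Mayer set `S′` that abut an outer multi-region polymer — it depends on `S′`; so the honest inner factor
is the `S′`-sum displayed in `eq5141_twoSpecies`, and the step *"z_F = (z_F/z) exp(log z)"* / (5.14.2) of p. 308 applies to it only after the layer is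
ignored (or estimated separately). NOT summit progress; NOT continuum; NOT Clay. Imports: `BIJ88Eq5134TwoSpecies`, `BIJ88Resummation5141Adm`; modifies
nothing. Cell `lit-balaban` Phase 2, seat p25 gen 9; row C2.Eq5.14.1-5.14.2 (owner r16, referee ref-5).
-/

open Finset
open Literature.Probability.LatticeModels (IsSetPartition setPartitions mem_setPartitions)
open Literature.MathematicalPhysics.QuantumFieldTheory.BalabanImbrieJaffe1984to88.BIJ88ElementaryRegions304
  (IsClosed region regions mem_region mem_region_self region_subset region_subset_of_isClosed isClosed_region inter_subset_region
   region_eq_of_mem isSetPartition_regions mem_regions region_mem_regions regions_restrict_of_isClosed)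
open Literature.MathematicalPhysics.QuantumFieldTheory.BalabanImbrieJaffe1984to88.BIJ88Resummation5141
  (outer mem_outer lam12 lam12_subset sum_setPartitions_split disjoint_of_outer_of_filling biUnion_subset_of_mem_outer
   polysIn mem_polysIn Compat restrictTo mem_restrictTo g2)
open Literature.MathematicalPhysics.QuantumFieldTheory.BalabanImbrieJaffe1984to88.BIJ88Resummation5141Adm (sum_adm_bigPart_subset inner_eq_corner)
open Literature.MathematicalPhysics.QuantumFieldTheory.BalabanImbrieJaffe1984to88.BIJ88Clusters5134
open Literature.MathematicalPhysics.QuantumFieldTheory.BalabanImbrieJaffe1984to88.BIJ88PolymerRep5134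
open Literature.MathematicalPhysics.QuantumFieldTheory.BalabanImbrieJaffe1984to88.BIJ88MayerExchange5134
open Literature.MathematicalPhysics.QuantumFieldTheory.BalabanImbrieJaffe1984to88.BIJ88Eq5134TwoSpecies

namespace Literature.MathematicalPhysics.QuantumFieldTheory.BalabanImbrieJaffe1984to88.BIJ88Eq5141TwoSpecies

variable {ι : Type*} [DecidableEq ι]

/-! ## §1 (A) The split of the two-species sum into the polymers overlapping Λ₁₁ᶜ and an inner sum over Λ₁₂ -/

section Split

variable (adj : ι → ι → Prop) [DecidableRel adj] {R : Type*} [CommRing R]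

/-- the polymer `X` KEEPS AWAY from the set of cubes `E` (the cubes of the interpolated outer polymers): no cube of `X` abuts, or is abutted by, a cube of
`E` — an inner multi-region cluster abutting an outer one would be part of it (p. 306 *"only adjacent □_i with s_i ≠ 0 interact"*).
[cite: BalabanImbrieJaffe1988, (5.14.1) p.308] -/
def Avoid (E X : Finset ι) : Prop := ∀ a ∈ X, ∀ e ∈ E, ¬ adj e a ∧ ¬ adj a e

/-- decidability of `Avoid`. [cite: BalabanImbrieJaffe1988, (5.14.1) p.308] -/
instance instDecidableAvoid (E X : Finset ι) : Decidable (Avoid adj E X) :=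
  inferInstanceAs (Decidable (∀ a ∈ X, ∀ e ∈ E, ¬ adj e a ∧ ¬ adj a e))

variable {adj}

omit [DecidableRel adj] in
/-- a union keeps away from `E` iff each member does. [cite: BalabanImbrieJaffe1988, (5.14.1) p.308] -/
theorem avoid_biUnion_iff {E : Finset ι} {K : Finset (Finset ι)} : Avoid adj E (K.biUnion id) ↔ ∀ X ∈ K, Avoid adj E X := by
  simp only [Avoid, mem_biUnion, id, forall_exists_index, and_imp]
  exact ⟨fun h X hX a ha e he => h a X hX ha e he, fun h a X hX ha e he => h X hX a ha e he⟩

omit [DecidableRel adj] in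
/-- **the hard core of a union of two disjoint families**: both hard-core, and every member of the second keeps away from the cubes of the first.
[cite: BalabanImbrieJaffe1988, (5.14.1) p.308] -/
theorem hardCore_union_iff {Mo Mi : Finset (Finset ι)} (hd : Disjoint Mo Mi) :
    HardCore adj (Mo ∪ Mi) ↔ HardCore adj Mo ∧ (HardCore adj Mi ∧ ∀ X ∈ Mi, Avoid adj (Mo.biUnion id) X) := by
  constructor
  · intro h
    refine ⟨h.mono subset_union_left, h.mono subset_union_right, fun X hX a ha e he => ?_⟩
    obtain ⟨X', hX', heX'⟩ := mem_biUnion.1 he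
    have hne : X' ≠ X := fun hXX => disjoint_left.1 hd hX' (hXX ▸ hX)
    exact ⟨h X' (mem_union_left _ hX') X (mem_union_right _ hX) hne e heX' a ha,
      h X (mem_union_right _ hX) X' (mem_union_left _ hX') hne.symm a ha e heX'⟩
  · rintro ⟨ho, hi, hav⟩ X hX X' hX' hne a ha b hb
    rcases mem_union.1 hX with hX | hX <;> rcases mem_union.1 hX' with hX' | hX'
    · exact ho X hX X' hX' hne a ha b hb
    · exact (hav X' hX' b hb a (mem_biUnion.2 ⟨X, hX, ha⟩)).1
    · exact (hav X hX a ha b (mem_biUnion.2 ⟨X', hX', hb⟩)).2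
    · exact hi X hX X' hX' hne a ha b hb

omit [DecidableRel adj] in
/-- complements of sub-families in a disjoint union of families. [cite: BalabanImbrieJaffe1988, (5.14.1) p.308] -/
theorem union_sdiff_union {ρ κ Mo Mi : Finset (Finset ι)} (hd : Disjoint ρ κ) (hMo : Mo ⊆ ρ) (hMi : Mi ⊆ κ) :
    (ρ ∪ κ) \ (Mo ∪ Mi) = (ρ \ Mo) ∪ (κ \ Mi) := by
  ext X
  simp only [mem_sdiff, mem_union, not_or]
  constructor
  · rintro ⟨hX | hX, hXo, hXi⟩
    · exact Or.inl ⟨hX, hXo⟩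
    · exact Or.inr ⟨hX, hXi⟩
  · rintro (⟨hX, hXo⟩ | ⟨hX, hXi⟩)
    · exact ⟨Or.inl hX, hXo, fun h => disjoint_left.1 hd hX (hMi h)⟩
    · exact ⟨Or.inr hX, fun h => disjoint_left.1 hd (hMo h) hX, hXi⟩

/-- **the two-species weight of a glued family splits**: summing the weight `Π_M b · Π_{rest} a` over the hard-core sub-families `M` of a disjoint union
`ρ ∪ κ` = summing over the hard-core `M_o ⊆ ρ` and, for each, over the hard-core `M_i ⊆ κ` keeping away from `∪M_o`, the product of the two weights.
[cite: BalabanImbrieJaffe1988, (5.14.1) p.308] -/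
theorem sum_hardCore_union {ρ κ : Finset (Finset ι)} (hd : Disjoint ρ κ) (a b : Finset ι → R) :
    ∑ M ∈ (ρ ∪ κ).powerset.filter (HardCore adj), (∏ X ∈ M, b X) * ∏ X ∈ (ρ ∪ κ) \ M, a X =
      ∑ Mo ∈ ρ.powerset.filter (HardCore adj), ((∏ X ∈ Mo, b X) * ∏ X ∈ ρ \ Mo, a X) *
        ∑ Mi ∈ κ.powerset.filter (fun Mi => HardCore adj Mi ∧ ∀ X ∈ Mi, Avoid adj (Mo.biUnion id) X),
          (∏ X ∈ Mi, b X) * ∏ X ∈ κ \ Mi, a X := by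
  rw [sum_filter, sum_powerset_union hd, sum_filter]
  refine sum_congr rfl fun Mo hMo => ?_
  have hMoρ : Mo ⊆ ρ := mem_powerset.1 hMo
  by_cases hHo : HardCore adj Mo
  · rw [if_pos hHo, mul_sum, sum_filter]
    refine sum_congr rfl fun Mi hMi => ?_
    have hMiκ : Mi ⊆ κ := mem_powerset.1 hMi
    have hdM : Disjoint Mo Mi := hd.mono hMoρ hMiκ
    by_cases hHi : HardCore adj Mi ∧ ∀ X ∈ Mi, Avoid adj (Mo.biUnion id) X
    · rw [if_pos ((hardCore_union_iff hdM).2 ⟨hHo, hHi⟩), if_pos hHi, prod_union hdM, union_sdiff_union hd hMoρ hMiκ,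
        prod_union (hd.mono sdiff_subset sdiff_subset)]
      ring
    · rw [if_neg (fun h => hHi ((hardCore_union_iff hdM).1 h).2), if_neg hHi]
  · rw [if_neg hHo]
    refine sum_eq_zero fun Mi hMi => ?_
    rw [if_neg]
    exact fun h => hHo (h.mono subset_union_left)

/-- **(A) THE SPLIT OF THE TWO-SPECIES SUM** (p. 308: *"Σ_{{X_α}} Π g₂(X_α) = Σ_{{X_α} overlapping Λ^{(k)c}_{11}} Π g₂(X_α) · [inner sum over Λ₁₂]"*, for the
honest two-species gas of `BIJ88Eq5134TwoSpecies.exchange5134`): a filling `Q` of `W` by polymers satisfying `c`, with hard-core multi-region family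
`M`, is (its outer family `ρ` = the polymers overlapping Λ₁₁ᶜ with `M_o = M ∩ ρ`, a filling `κ` of `Λ₁₂ = lam12 W ρ` with `M_i = M ∩ κ`), the hard core of
`M` being: hard core of `M_o`, hard core of `M_i`, and the members of `M_i` keep away from `∪M_o` — for all weights `a`, `b`.
[cite: BalabanImbrieJaffe1988, (5.14.1) p.308] -/
theorem twoSpecies_split (W B : Finset ι) (c : Finset ι → Prop) [DecidablePred c] (a b : Finset ι → R) :
    ∑ Q ∈ (setPartitions W).filter (fun Q => ∀ X ∈ Q, c X),
        ∑ M ∈ Q.powerset.filter (HardCore adj), (∏ X ∈ M, b X) * ∏ X ∈ Q \ M, a X =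
      ∑ ρ ∈ (outer W B).filter (fun ρ => ∀ X ∈ ρ, c X),
        ∑ Mo ∈ ρ.powerset.filter (HardCore adj),
          ((∏ X ∈ Mo, b X) * ∏ X ∈ ρ \ Mo, a X) *
            ∑ κ ∈ (setPartitions (lam12 W ρ)).filter (fun κ => ∀ X ∈ κ, c X),
              ∑ Mi ∈ κ.powerset.filter (fun Mi => HardCore adj Mi ∧ ∀ X ∈ Mi, Avoid adj (Mo.biUnion id) X),
                (∏ X ∈ Mi, b X) * ∏ X ∈ κ \ Mi, a X := by
  rw [sum_filter, sum_setPartitions_split W B, sum_filter]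
  refine sum_congr rfl fun ρ hρ => ?_
  -- bring the right side to the form `Σ_κ (if … then … else 0)`
  have hR : (if (∀ X ∈ ρ, c X) then
        ∑ Mo ∈ ρ.powerset.filter (HardCore adj), ((∏ X ∈ Mo, b X) * ∏ X ∈ ρ \ Mo, a X) *
          ∑ κ ∈ (setPartitions (lam12 W ρ)).filter (fun κ => ∀ X ∈ κ, c X),
            ∑ Mi ∈ κ.powerset.filter (fun Mi => HardCore adj Mi ∧ ∀ X ∈ Mi, Avoid adj (Mo.biUnion id) X),
              (∏ X ∈ Mi, b X) * ∏ X ∈ κ \ Mi, a X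
        else 0) =
      ∑ κ ∈ setPartitions (lam12 W ρ), if (∀ X ∈ ρ, c X) ∧ (∀ X ∈ κ, c X) then
        ∑ Mo ∈ ρ.powerset.filter (HardCore adj), ((∏ X ∈ Mo, b X) * ∏ X ∈ ρ \ Mo, a X) *
          ∑ Mi ∈ κ.powerset.filter (fun Mi => HardCore adj Mi ∧ ∀ X ∈ Mi, Avoid adj (Mo.biUnion id) X),
            (∏ X ∈ Mi, b X) * ∏ X ∈ κ \ Mi, a X else 0 := by
    by_cases hcρ : ∀ X ∈ ρ, c X
    · rw [if_pos hcρ, sum_congr rfl fun κ _ => if_congr (and_iff_right hcρ) rfl rfl, ← sum_filter]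
      simp_rw [mul_sum]
      rw [sum_comm]
    · rw [if_neg hcρ]
      symm
      exact sum_eq_zero fun κ _ => if_neg fun h => hcρ h.1
  rw [hR]
  refine sum_congr rfl fun κ hκ => ?_
  have hκp : IsSetPartition (lam12 W ρ) κ := mem_setPartitions.1 hκ
  have hd : Disjoint ρ κ := disjoint_of_outer_of_filling hρ hκp
  have hiff : (∀ X ∈ ρ ∪ κ, c X) ↔ (∀ X ∈ ρ, c X) ∧ (∀ X ∈ κ, c X) := forall_mem_union
  by_cases hc : (∀ X ∈ ρ, c X) ∧ (∀ X ∈ κ, c X)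
  · rw [if_pos (hiff.2 hc), if_pos hc, sum_hardCore_union hd a b]
  · rw [if_neg (fun h => hc (hiff.1 h)), if_neg hc]

end Split

/-! ## §2 (B) The inner resummation in Λ₁₂: back to the expectations, with the regions abutting the outer multi-region polymers decoupled -/

section Inner

variable {adj : ι → ι → Prop} [DecidableRel adj] {R : Type*} [CommRing R] {J₀ Ys : Finset (Finset ι)} {W : Finset ι}

/-- the local elementary regions of a polymer inside `L` may be computed with the joining sets inside `L`.
[cite: BalabanImbrieJaffe1988, p.304 (Sect. 5.13)] -/
theorem localI_restrict {L X : Finset ι} (hXL : X ⊆ L) (T : Finset (Finset ι)) : localI (restrictTo J₀ L) X T = localI J₀ X T := by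
  rw [localI, localI, restrictTo_restrictTo hXL]

/-- species A inside `L` computed with the rules inside `L`. [cite: BalabanImbrieJaffe1988, (5.13.4) p.306] -/
theorem gA_restrict (g : Finset ι → Finset (Finset ι) → R) {L X : Finset ι} (hXL : X ⊆ L) :
    gA (restrictTo J₀ L) Ys g X = gA J₀ Ys g X := by
  rw [gA, gA]
  refine sum_congr (filter_congr fun T _ => ?_) fun _ _ => rfl
  rw [IsMulti, IsMulti, localI_restrict hXL]

/-- species B inside `L` computed with the rules inside `L`. [cite: BalabanImbrieJaffe1988, (5.13.4) p.306] -/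
theorem gB_restrict (g : Finset ι → Finset (Finset ι) → R) {L X : Finset ι} (hXL : X ⊆ L) :
    gB (restrictTo J₀ L) Ys g X = gB J₀ Ys g X := by
  rw [gB, gB]
  refine sum_congr (filter_congr fun T _ => ?_) fun _ _ => rfl
  rw [IsMulti, IsMulti, localI_restrict hXL]

/-- inside a closed sub-region `L`, closedness in `W` is closedness in `L` for the joining sets inside `L`.
[cite: BalabanImbrieJaffe1988, p.304 (Sect. 5.13)] -/
theorem isClosed_restrict_iff (hJ₀ : ∀ Y ∈ J₀, Y ⊆ W) {L X : Finset ι} (hLc : IsClosed J₀ W L) (hXL : X ⊆ L) :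
    IsClosed J₀ W X ↔ IsClosed (restrictTo J₀ L) L X := by
  constructor
  · intro h Y hY hm y hy
    obtain ⟨hYJ, -⟩ := mem_restrictTo.1 hY
    exact h Y hYJ hm (mem_inter.2 ⟨(mem_inter.1 hy).1, hJ₀ Y hYJ (mem_inter.1 hy).1⟩)
  · intro h Y hY hm y hy
    have hmL : (Y ∩ L).Nonempty := by
      obtain ⟨k, hk⟩ := hm
      exact ⟨k, mem_inter.2 ⟨(mem_inter.1 hk).1, hXL (mem_inter.1 hk).2⟩⟩
    have hYL : Y ⊆ L := fun v hv => hLc Y hY hmL (mem_inter.2 ⟨hv, hJ₀ Y hY hv⟩)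
    exact h Y (mem_restrictTo.2 ⟨hY, hYL⟩) hm (mem_inter.2 ⟨(mem_inter.1 hy).1, hYL (mem_inter.1 hy).1⟩)

/-- **Λ₁₂ is closed under the rules when the outer polymers are**: the complement of a union of closed blocks is closed.
[cite: BalabanImbrieJaffe1988, p.306 (Sect. 5.13)] -/
theorem isClosed_lam12 {J : Finset (Finset ι)} {ρ : Finset (Finset ι)} (hcl : ∀ X ∈ ρ, IsClosed J W X) :
    IsClosed J W (lam12 W ρ) := by
  intro Y hY hm y hy
  obtain ⟨k, hk⟩ := hm
  obtain ⟨hkY, hk12⟩ := mem_inter.1 hk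
  obtain ⟨hyY, hyW⟩ := mem_inter.1 hy
  refine mem_sdiff.2 ⟨hyW, fun hyU => ?_⟩
  obtain ⟨X, hX, hyX⟩ := mem_biUnion.1 hyU
  have hsub : Y ∩ W ⊆ X := hcl X hX Y hY ⟨y, mem_inter.2 ⟨hyY, hyX⟩⟩
  exact (mem_sdiff.1 hk12).2 (mem_biUnion.2 ⟨X, hX, hsub (mem_inter.2 ⟨hkY, lam12_subset W ρ hk12⟩)⟩)

/-- Mayer polymers inside a sub-region are inside the region. [cite: BalabanImbrieJaffe1988, (5.14.1) p.308] -/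
theorem polysIn_mono {L : Finset ι} (hL : L ⊆ W) : polysIn Ys L ⊆ polysIn Ys W := fun _ hY =>
  mem_polysIn.2 ⟨(mem_polysIn.1 hY).1, (mem_polysIn.1 hY).2.trans hL⟩

/-- **the regions of an inner Mayer set in a closed sub-region are global regions**: for `S′` made of Mayer polymers inside the `J₀`-closed `L ⊆ W`,
`localI J₀ L S′ = (regions (J₀ ∪ S′) W).filter (· ⊆ L)`. [cite: BalabanImbrieJaffe1988, p.306 (Sect. 5.13)] -/
theorem localI_eq_filter_of_subset (hJ₀ : ∀ Y ∈ J₀, Y ⊆ W) {L : Finset ι} (hL : L ⊆ W) (hLc : IsClosed J₀ W L) {S' : Finset (Finset ι)}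
    (hS' : S' ⊆ polysIn Ys L) : localI J₀ L S' = (regions (J₀ ∪ S') W).filter (· ⊆ L) := by
  have hS'L : ∀ Y ∈ S', Y ⊆ L := fun Y hY => (mem_polysIn.1 (hS' hY)).2
  have hJ : ∀ Y ∈ J₀ ∪ S', Y ⊆ W := fun Y hY => (mem_union.1 hY).elim (hJ₀ Y) (fun h => (hS'L Y h).trans hL)
  have hres : restrictTo S' L = S' := by
    ext Y
    simp only [mem_restrictTo, and_iff_left_iff_imp]
    exact hS'L Y
  have hLc' : IsClosed (J₀ ∪ S') W L := by
    refine isClosed_union_iff.2 ⟨hLc, fun Y hY _ y hy => hS'L Y hY (mem_inter.1 hy).1⟩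
  have h := localI_eq_filter hJ hL hLc'
  rw [hres] at h
  exact h

omit [DecidableEq ι] in
/-- for a set of regions, "every multi-region member keeps away from `E`" is "the interpolated regions lie among those keeping away from `E`".
[cite: BalabanImbrieJaffe1988, (5.14.1) p.308] -/
theorem forall_avoid_iff_bigPart_subset [DecidableEq ι] {E : Finset ι} {I' : Finset (Finset ι)} {P : Finset (Finset (Finset ι))}
    (hP : IsSetPartition I' P) :
    (∀ K ∈ P, 2 ≤ K.card → Avoid adj E (K.biUnion id)) ↔ bigPart P ⊆ I'.filter (Avoid adj E) := by
  constructor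
  · intro h Rg hRg
    simp only [bigPart, mem_biUnion, mem_filter, id] at hRg
    obtain ⟨K, ⟨hK, h2⟩, hRK⟩ := hRg
    exact mem_filter.2 ⟨hP.subset hK hRK, (avoid_biUnion_iff.1 (h K hK h2)) Rg hRK⟩
  · intro h K hK h2
    refine avoid_biUnion_iff.2 fun Rg hRK => (mem_filter.1 (h ?_)).2
    simp only [bigPart, mem_biUnion, mem_filter, id]
    exact ⟨K, ⟨hK, h2⟩, hRK⟩

/-- **the inner resummation at fixed inner Mayer data** (gen-8 `BIJ88Resummation5141Adm.sum_adm_bigPart_subset`, the region-level instance): for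
cluster-factorizing corner data on a set `I′` of regions, the admissible fillings of `I′` whose multi-region members keep away from `E` resum to the
expectation with the regions NOT keeping away from `E` decoupled: `= z I′ (I′.filter (Avoid E))`. [cite: BalabanImbrieJaffe1988, (5.14.1) p.308] -/
theorem inner_fixed {zS : Finset (Finset ι) → Finset (Finset ι) → R} (hz : IsClusterFactorizing (radj adj) zS) (I' : Finset (Finset ι))
    (E : Finset ι) :
    ∑ P ∈ (setPartitions I').filter (fun P => IsAdmissible (radj adj) P ∧ ∀ K ∈ P, 2 ≤ K.card → Avoid adj E (K.biUnion id)),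
        ∏ K ∈ P, g1 (radj adj) zS K = zS I' (I'.filter (Avoid adj E)) := by
  have hf : (setPartitions I').filter (fun P => IsAdmissible (radj adj) P ∧ ∀ K ∈ P, 2 ≤ K.card → Avoid adj E (K.biUnion id)) =
      (setPartitions I').filter (fun P => IsAdmissible (radj adj) P ∧ bigPart P ⊆ I'.filter (Avoid adj E)) :=
    filter_congr fun P hP => by rw [forall_avoid_iff_bigPart_subset (mem_setPartitions.1 hP)]
  rw [hf, sum_adm_bigPart_subset hz (filter_subset _ I'), inner_eq_corner hz (filter_subset _ I')]

variable (adj J₀ Ys W) in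
/-- **(B) THE INNER RESUMMATION IN Λ₁₂** (*"we resum the decoupling and Mayer expansions in Λ^{(k)}_{12}"*, read backwards for the honest gas): for a
`J₀`-closed sub-region `L ⊆ W` (Λ₁₂) and a set `E` of cubes (those of the outer multi-region polymers), the inner two-species sum over `L` — fillings by
`J₀`-closed polymers, hard-core multi-region family keeping away from `E`, weights `gB`/`gA` built from the printed `g₁` of local cluster-factorizing
corner data `z` — equals `Σ_{S′ ⊆ 𝒫(L)} z S′ (I_L(S′)) ((I_L(S′)).filter (Avoid E))`, `I_L(S′) = localI J₀ L S′` the elementary regions of the inner Mayer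
set: for each `S′` the expectation over the fields of `L` with the regions of `S′` abutting `E` DECOUPLED (`exchange5134_cond` + `inner_fixed`).
[cite: BalabanImbrieJaffe1988, (5.14.1) p.308] -/
theorem inner_resummed (hJ₀ : ∀ Y ∈ J₀, Y ⊆ W) (hYs : ∀ Y ∈ Ys, Y.Nonempty)
    (z : Finset (Finset ι) → Finset (Finset ι) → Finset (Finset ι) → R)
    (hz : ∀ S ⊆ polysIn Ys W, IsClusterFactorizing (radj adj) (z S))
    (hloc : ∀ S ⊆ polysIn Ys W, ∀ K ⊆ regions (J₀ ∪ S) W, ∀ Λ ⊆ K, z S K Λ = z (restrictTo S (K.biUnion id)) K Λ)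
    {L : Finset ι} (hL : L ⊆ W) (hLc : IsClosed J₀ W L) (E : Finset ι) :
    ∑ κ ∈ (setPartitions L).filter (fun κ => ∀ X ∈ κ, IsClosed J₀ W X),
        ∑ Mi ∈ κ.powerset.filter (fun Mi => HardCore adj Mi ∧ ∀ X ∈ Mi, Avoid adj E X),
          (∏ X ∈ Mi, gB J₀ Ys (fun X T => g1 (radj adj) (z T) (localI J₀ X T)) X) *
            ∏ X ∈ κ \ Mi, gA J₀ Ys (fun X T => g1 (radj adj) (z T) (localI J₀ X T)) X =
      ∑ S' ∈ (polysIn Ys L).powerset, z S' (localI J₀ L S') ((localI J₀ L S').filter (Avoid adj E)) := by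
  set g : Finset ι → Finset (Finset ι) → R := fun X T => g1 (radj adj) (z T) (localI J₀ X T) with hg
  have hJ₀' : ∀ Y ∈ restrictTo J₀ L, Y ⊆ L := fun Y hY => (mem_restrictTo.1 hY).2
  -- (1) the left side is the right side of `exchange5134_cond` in `L` with the rules inside `L`
  have h1 : ∑ κ ∈ (setPartitions L).filter (fun κ => ∀ X ∈ κ, IsClosed J₀ W X),
        ∑ Mi ∈ κ.powerset.filter (fun Mi => HardCore adj Mi ∧ ∀ X ∈ Mi, Avoid adj E X),
          (∏ X ∈ Mi, gB J₀ Ys g X) * ∏ X ∈ κ \ Mi, gA J₀ Ys g X =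
      ∑ κ ∈ (setPartitions L).filter (fun κ => ∀ X ∈ κ, IsClosed (restrictTo J₀ L) L X),
        ∑ Mi ∈ κ.powerset.filter (fun Mi => HardCore adj Mi ∧ ∀ X ∈ Mi, Avoid adj E X),
          (∏ X ∈ Mi, gB (restrictTo J₀ L) Ys g X) * ∏ X ∈ κ \ Mi, gA (restrictTo J₀ L) Ys g X := by
    have hfl : (setPartitions L).filter (fun κ => ∀ X ∈ κ, IsClosed J₀ W X) =
        (setPartitions L).filter (fun κ => ∀ X ∈ κ, IsClosed (restrictTo J₀ L) L X) :=
      filter_congr fun κ hκ => forall₂_congr fun X hX =>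
        isClosed_restrict_iff hJ₀ hLc ((mem_setPartitions.1 hκ).subset hX)
    rw [hfl]
    refine sum_congr rfl fun κ hκ => sum_congr rfl fun Mi hMi => ?_
    have hκp : IsSetPartition L κ := mem_setPartitions.1 (mem_filter.1 hκ).1
    have hMiκ : Mi ⊆ κ := mem_powerset.1 (mem_filter.1 hMi).1
    rw [prod_congr rfl fun X hX => (gB_restrict (J₀ := J₀) (Ys := Ys) g (hκp.subset (hMiκ hX))).symm,
      prod_congr rfl fun X hX => (gA_restrict (J₀ := J₀) (Ys := Ys) g (hκp.subset (mem_sdiff.1 hX).1)).symm]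
  rw [h1, ← exchange5134_cond adj (restrictTo J₀ L) Ys L (Avoid adj E) hJ₀' hYs g]
  -- (2) at fixed inner Mayer data the activities are the fixed-`S′` printed ones, and `inner_fixed` applies
  refine sum_congr rfl fun S' hS' => ?_
  have hS'L : S' ⊆ polysIn Ys L := mem_powerset.1 hS'
  have hS'W : S' ⊆ polysIn Ys W := hS'L.trans (polysIn_mono hL)
  have hI : regions (restrictTo J₀ L ∪ S') L = localI J₀ L S' := rfl
  have hsub : localI J₀ L S' ⊆ regions (J₀ ∪ S') W := by
    rw [localI_eq_filter_of_subset hJ₀ hL hLc hS'L]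
    exact filter_subset _ _
  rw [hI]
  have h2 : ∀ P ∈ (setPartitions (localI J₀ L S')).filter
        (fun P => IsAdmissible (radj adj) P ∧ ∀ K ∈ P, 2 ≤ K.card → Avoid adj E (K.biUnion id)),
      ∏ K ∈ P, g (K.biUnion id) (restrictTo S' (K.biUnion id)) = ∏ K ∈ P, g1 (radj adj) (z S') K := by
    intro P hP
    have hPp : IsSetPartition (localI J₀ L S') P := mem_setPartitions.1 (mem_filter.1 hP).1
    refine prod_congr rfl fun K hK => ?_
    exact (g1_eq_local adj J₀ Ys W hJ₀ z hloc hS'W ((hPp.subset hK).trans hsub)).symm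
  rw [sum_congr rfl h2, inner_fixed (hz S' hS'W) (localI J₀ L S') E]

end Inner

/-! ## §3 (5.14.1) for the honest expansion -/

section Assembly

variable (adj : ι → ι → Prop) [DecidableRel adj] {R : Type*} [CommRing R] (J₀ Ys : Finset (Finset ι)) (W B : Finset ι)

/-- **DISPLAY (5.14.1), HONEST FORM** (p. 308 [PDF 52], verbatim: *"To extract the perturbative terms, we resum the decoupling and Mayer expansions in
Λ^{(k)}_{12}. … We obtain for the expansion in (5.13.4) Σ_{{X_α}} Π_α g₂(X_α) = Σ_{{X_α} overlapping Λ^{(k)c}_{11}} Π_α g₂(X_α) z_F(Λ^{(k)}_{12}), where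
z_F(Λ^{(k)}_{12}) = ⟨χ′_{Λ^{(k)}_{12}} Π_{σ₁: X_{σ₁}⊂Λ^{(k)}_{12}} F^{m̄}_{k,loc}(X_{σ₁}) e^{−Ṽ^{(k)}(Λ^{(k)}_{12})}⟩_{1,Λ^{(k)}_{12}} … (5.14.1)"*). For local
cluster-factorizing corner data `z S` on the elementary regions of each Mayer set `S` (hypotheses of `BIJ88Eq5134TwoSpecies.eq5134_right`), the
`S`-summed expansion `Σ_{S ⊆ 𝒫(W)} ⟨Π_{i∈I(S)} f_S(□_i)⟩_1 = Σ_S z S I(S) I(S)` equals the sum over the families `ρ = {X_α}` OVERLAPPING Λ₁₁ᶜ (outer families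
of `J₀`-closed polymers covering the large-field cubes `B`) and their hard-core multi-region sub-families `M_o` of the two-species weights
`Π_{M_o} g₂ᴮ · Π_{ρ∖M_o} g₂ᴬ`, times THE INNER FACTOR `Σ_{S′ ⊆ 𝒫(Λ₁₂)} z S′ (I₁₂ S′) ((I₁₂ S′).filter (Avoid (∪M_o)))` — for each inner Mayer set the
expectation over the fields of `Λ₁₂ = lam12 W ρ` with the regions of `S′` abutting an outer multi-region polymer decoupled; this is the honest
counterpart of the printed `z_F(Λ^{(k)}_{12})` (cf. gen-7 `BIJ88Resummation5141.zF_eq_sum_zS`: `z_F = Σ_{S′} ⟨G Π_{Y∈S′}(b_Y − 1)⟩` with NO layer).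
[cite: BalabanImbrieJaffe1988, (5.14.1) p.308] -/
theorem eq5141_twoSpecies (hJ₀ : ∀ Y ∈ J₀, Y ⊆ W) (hYs : ∀ Y ∈ Ys, Y.Nonempty)
    (z : Finset (Finset ι) → Finset (Finset ι) → Finset (Finset ι) → R)
    (hz : ∀ S ⊆ polysIn Ys W, IsClusterFactorizing (radj adj) (z S))
    (hloc : ∀ S ⊆ polysIn Ys W, ∀ K ⊆ regions (J₀ ∪ S) W, ∀ Λ ⊆ K, z S K Λ = z (restrictTo S (K.biUnion id)) K Λ) :
    ∑ S ∈ (polysIn Ys W).powerset, z S (regions (J₀ ∪ S) W) (regions (J₀ ∪ S) W) =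
      ∑ ρ ∈ (outer W B).filter (fun ρ => ∀ X ∈ ρ, IsClosed J₀ W X),
        ∑ Mo ∈ ρ.powerset.filter (HardCore adj),
          ((∏ X ∈ Mo, gB J₀ Ys (fun X T => g1 (radj adj) (z T) (localI J₀ X T)) X) *
              ∏ X ∈ ρ \ Mo, gA J₀ Ys (fun X T => g1 (radj adj) (z T) (localI J₀ X T)) X) *
            ∑ S' ∈ (polysIn Ys (lam12 W ρ)).powerset,
              z S' (localI J₀ (lam12 W ρ) S') ((localI J₀ (lam12 W ρ) S').filter (Avoid adj (Mo.biUnion id))) := by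
  rw [eq5134_right adj J₀ Ys W hJ₀ hYs z hz hloc,
    twoSpecies_split (adj := adj) W B (fun X => IsClosed J₀ W X)
      (gA J₀ Ys (fun X T => g1 (radj adj) (z T) (localI J₀ X T))) (gB J₀ Ys (fun X T => g1 (radj adj) (z T) (localI J₀ X T)))]
  refine sum_congr rfl fun ρ hρ => sum_congr rfl fun Mo _ => ?_
  obtain ⟨hρ, hcl⟩ := mem_filter.1 hρ
  rw [inner_resummed adj J₀ Ys W hJ₀ hYs z hz hloc (lam12_subset W ρ) (isClosed_lam12 hcl) (Mo.biUnion id)]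

/-- **`eq5141_twoSpecies` is not vacuous**: it holds for the local cluster-product corner data `zLoc` of `BIJ88MayerExchange5134` with no hypothesis
beyond the nonemptiness of the Mayer polymers and the joining sets being sets of cubes of `W`. [cite: BalabanImbrieJaffe1988, (5.14.1) p.308] -/
theorem eq5141_twoSpecies_zLoc (hJ₀ : ∀ Y ∈ J₀, Y ⊆ W) (hYs : ∀ Y ∈ Ys, Y.Nonempty) (w : Finset ι → Finset (Finset ι) → R) :
    ∑ S ∈ (polysIn Ys W).powerset, zLoc adj w S (regions (J₀ ∪ S) W) (regions (J₀ ∪ S) W) =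
      ∑ ρ ∈ (outer W B).filter (fun ρ => ∀ X ∈ ρ, IsClosed J₀ W X),
        ∑ Mo ∈ ρ.powerset.filter (HardCore adj),
          ((∏ X ∈ Mo, gB J₀ Ys (fun X T => g1 (radj adj) (zLoc adj w T) (localI J₀ X T)) X) *
              ∏ X ∈ ρ \ Mo, gA J₀ Ys (fun X T => g1 (radj adj) (zLoc adj w T) (localI J₀ X T)) X) *
            ∑ S' ∈ (polysIn Ys (lam12 W ρ)).powerset,
              zLoc adj w S' (localI J₀ (lam12 W ρ) S') ((localI J₀ (lam12 W ρ) S').filter (Avoid adj (Mo.biUnion id))) :=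
  eq5141_twoSpecies adj J₀ Ys W B hJ₀ hYs (zLoc adj w) (fun S _ => isClusterFactorizing_zLoc adj w S)
    fun S _ K _ Λ _ => zLoc_local adj w S K Λ

end Assembly

end Literature.MathematicalPhysics.QuantumFieldTheory.BalabanImbrieJaffe1984to88.BIJ88Eq5141TwoSpecies
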